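import Summits.QuantumAdvantage.QuantumAdvantage.Theorems.NearExactIsExact.Negative.RMDual
import Summits.QuantumAdvantage.QuantumAdvantage.Theorems.CubicForrelationNearExactIsExactRothausB

/-!
# `NearExactIsExact` (stmt-QuantumAdvantage-14043) — negative-side tool: the exceptional residues of an odd signed set lie in `RM(2,m)`

B2b disprover cell (gen 27), first of three files proving THEOREM MM59-W (type-O Maiorana–McFarland
functions over a quadratic map `𝔽₂⁹ → 𝔽₂⁵` have capacity `≤ 59/64` at `n = 14`; see
`Negative.TypeOMM59WindowFourteen`). HONEST FRAMING: a kernel-checked lemma about character sums of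
finite signed point sets in `𝔽₂^m`, NOT summit progress.

Setting: `A ⊆ 𝔽₂^m` a finite set with odd integer weights `ε` and odd total `S = Σ_{y∈A} ε_y`, centroid
`c = c(A)`, signed character sums `χ_A(b) = Σ_{y ∈ A} ε_y (-1)^{b·y}`. By the mod-4 law
(`CentroidMoments.charSum_sub_dvd_four`) `χ_A(b) = S(-1)^{b·c} + 4 g(b)` with `g(b) ∈ ℤ`.
* `two_pow_dvd_sum_powerset_zt`: cube sums of characters, `Σ_{J ⊆ T} (-1)^{1_J · y} = Π_{i∈T}(1 + (-1)^{y_i})`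
  is divisible by `2^{|T|}`; hence (`anf_vanish`) the parity function `G = [g odd] = [χ_A − S(-1)^{b·c} ≡ 4 (8)]`
  has all cube sums over cubes of dimension `≥ 3` even, i.e. its ANF coefficients of degree `≥ 3` vanish.
* `isDegLeFun_of_anf_eq_zero`: vanishing of the ANF coefficients `a_S`, `|S| > k`, gives degree `≤ k`
  (the Möbius/ANF expansion of `RMDual`); so `deg G ≤ 2`.
* `exc_iff`, `isDegLeFun_exc`: since `{±1} (mod 8)` is symmetric, the EXCEPTIONAL SET
  `E_A = {b : χ_A(b) ≡ ±1 (mod 8)}` is `{G = [S ≡ ±3 (8)]}`, the support of a word of `RM(2,m)`;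
* `exc_card_ge` (`m = 9`): `E_A = ∅` or `#E_A ≥ 2⁷ = 128` (`bb_rmWeight_holds`).
Sources: [this work]; folklore tools as cited inline (MacWilliams–Sloane Ch. 13 for the ANF and the
Reed–Muller minimum weight; C. Carlet, Boolean Functions for Cryptography and Coding Theory (2020) §5.1 for
the Maiorana–McFarland context). Standard axioms only.
-/

set_option linter.dupNamespace false -- D-0017: single-problem summit ⇒ `QuantumAdvantage.QuantumAdvantage` by design

namespace Summit.QuantumAdvantage.QuantumAdvantage.Theorems.NearExactIsExact.Negative.FibreResidueRM

open Finset
open Literature.Computability.QuantumComplexity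
open Summit.QuantumAdvantage.QuantumAdvantage.Theorems.CubicForrelation.NearExactIsExact (bb_rmWeight_holds)
open Summit.QuantumAdvantage.QuantumAdvantage.Theorems.NearExactIsExact.Negative.CentroidMoments
open Summit.QuantumAdvantage.QuantumAdvantage.Theorems.NearExactIsExact.Negative.SkewProductCore
  (ind indic decide_ind_eq_one isDegLeFun_sum isDegLeFun_prod)
open Summit.QuantumAdvantage.QuantumAdvantage.Theorems.NearExactIsExact.Negative.RMDual (ind_eq_sum_prod_anf)

variable {m : ℕ}

/-! ### Vanishing high ANF coefficients give a degree bound -/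

/-- If the ANF coefficients `a_S(g) = Σ_{J ⊆ S} g(1_J)` vanish for all `|S| > k`, then `deg g ≤ k`
(Möbius expansion `g(x) = Σ_S x^S a_S(g)`). [folklore] -/
theorem isDegLeFun_of_anf_eq_zero {g : (Fin m → Bool) → Bool} {k : ℕ}
    (h : ∀ S : Finset (Fin m), k < #S → (∑ J ∈ S.powerset, ind (g (indic J))) = 0) :
    IsDegLeFun k g := by
  have e : g = fun x => decide ((∑ S ∈ univ.filter (fun S : Finset (Fin m) => #S ≤ k),
      (∏ i ∈ S, ind (x i)) * (∑ J ∈ S.powerset, ind (g (indic J)))) = 1) := by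
    funext x
    have h1 : ind (g x) = ∑ S ∈ univ.filter (fun S : Finset (Fin m) => #S ≤ k),
        (∏ i ∈ S, ind (x i)) * (∑ J ∈ S.powerset, ind (g (indic J))) := by
      rw [ind_eq_sum_prod_anf, ← sum_filter_add_sum_filter_not univ (fun S : Finset (Fin m) => #S ≤ k)]
      have h0 : ∑ S ∈ univ.filter (fun S : Finset (Fin m) => ¬ #S ≤ k),
          (∏ i ∈ S, ind (x i)) * (∑ J ∈ S.powerset, ind (g (indic J))) = 0 :=
        sum_eq_zero fun S hS => by
          rw [h S (by have := (mem_filter.mp hS).2; omega), mul_zero]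
      rw [h0, add_zero]
    rw [← h1, decide_ind_eq_one]
  rw [e]
  refine isDegLeFun_sum (fun (S : Finset (Fin m)) (x : Fin m → Bool) =>
      (∏ i ∈ S, ind (x i)) * (∑ J ∈ S.powerset, ind (g (indic J)))) _ fun S hS => ?_
  have hSk : #S ≤ k := (mem_filter.mp hS).2
  rcases (by decide : ∀ a : ZMod 2, a = 0 ∨ a = 1) (∑ J ∈ S.powerset, ind (g (indic J))) with h0 | h1
  · have e0 : (fun x : Fin m → Bool =>
        decide ((∏ i ∈ S, ind (x i)) * (∑ J ∈ S.powerset, ind (g (indic J))) = 1)) = fun _ => false := by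
      funext x
      rw [h0, mul_zero]
      decide
    rw [e0]
    exact isDegLeFun_const k false
  · simp_rw [h1, mul_one]
    exact (isDegLeFun_prod (fun i (x : Fin m → Bool) => x i) S
      (fun i _ => isDegLeFun_apply i le_rfl)).mono (by omega)

/-! ### Cube sums of characters -/

/-- `1_{J ∪ {i}} = e_i ⊕ 1_J` for `i ∉ J`. [folklore] -/
theorem indic_insert {i : Fin m} {J : Finset (Fin m)} (hi : i ∉ J) :
    indic (insert i J) = fun j => xor (unitVec i j) (indic J j) := by
  funext j
  unfold indic unitVec
  by_cases hj : j = i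
  · subst hj
    simp [hi]
  · simp [hj]

/-- `1_∅ = 0`. [folklore] -/
theorem indic_empty : indic (∅ : Finset (Fin m)) = fun _ => false := by
  funext j
  simp [indic]

/-- **Cube sums of a character**: `2^{|T|} ∣ Σ_{J ⊆ T} (-1)^{1_J · y}` (the sum is
`Π_{i ∈ T} (1 + (-1)^{y_i})`). [folklore] -/
theorem two_pow_dvd_sum_powerset_zt (y : Fin m → Bool) (T : Finset (Fin m)) :
    (2 : ℤ) ^ #T ∣ ∑ J ∈ T.powerset, zt (indic J) y := by
  induction T using Finset.induction_on with
  | empty =>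
    rw [powerset_empty, sum_singleton, card_empty, pow_zero, indic_empty, zt_zero]
  | insert i T hi ih =>
    rw [sum_powerset_insert hi, card_insert_of_notMem hi, pow_succ]
    have e : ∀ J ∈ T.powerset, zt (indic (insert i J)) y = zt (indic J) y * (if y i then -1 else 1) := by
      intro J hJ
      have hiJ : i ∉ J := fun h' => hi (mem_powerset.mp hJ h')
      rw [indic_insert hiJ, zt_xor, zt_unitVec, mul_comm]
    rw [sum_congr rfl e, ← sum_mul, ← mul_one_add]
    exact mul_dvd_mul ih (by split_ifs <;> norm_num)

/-! ### The residues of an odd signed set -/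

section SignedSet

variable (A : Finset (Fin m → Bool)) (ε : (Fin m → Bool) → ℤ)

/-- Cube sums of signed character sums: `2^{|T|} ∣ Σ_{J ⊆ T} χ_A(1_J)`. [folklore] -/
theorem two_pow_dvd_sum_powerset_charSum (T : Finset (Fin m)) :
    (2 : ℤ) ^ #T ∣ ∑ J ∈ T.powerset, ∑ y ∈ A, ε y * zt (indic J) y := by
  rw [sum_comm]
  exact dvd_sum fun y _ => by
    rw [← mul_sum]
    exact (two_pow_dvd_sum_powerset_zt y T).mul_left _

variable {A ε}

/-- **The correction term has degree `≤ 2` (ANF form).** With `χ_A(b) = S(-1)^{b·c} + 4g(b)`, the parity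
`[g(1_J) odd] = [χ_A(1_J) − S(-1)^{1_J·c} ≡ 4 (mod 8)]` sums to zero over every cube `{J ⊆ T}`, `|T| ≥ 3`
(both `Σ_J χ_A(1_J)` and `S Σ_J (-1)^{1_J·c}` are divisible by `2^{|T|}`, each term by `4`). [this work] -/
theorem anf_vanish (hε : ∀ y, Odd (ε y)) (hS : Odd (∑ y ∈ A, ε y)) (T : Finset (Fin m)) (hT : 2 < #T) :
    (∑ J ∈ T.powerset, ind (decide ((∑ y ∈ A, ε y * zt (indic J) y -
        (∑ y ∈ A, ε y) * zt (indic J) (cen A)) % 8 = 4))) = 0 := by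
  set w : Finset (Fin m) → ℤ := fun J =>
    ∑ y ∈ A, ε y * zt (indic J) y - (∑ y ∈ A, ε y) * zt (indic J) (cen A) with hw
  have h4 : ∀ J, (4 : ℤ) ∣ w J := fun J => charSum_sub_dvd_four A ε hε hS (indic J)
  have h8' : (8 : ℤ) ∣ (2 : ℤ) ^ #T := by
    obtain ⟨r, hr⟩ := Nat.exists_eq_add_of_le hT
    exact ⟨2 ^ r, by rw [hr, pow_add]; norm_num⟩
  have h8 : (8 : ℤ) ∣ ∑ J ∈ T.powerset, w J := by
    simp only [hw, sum_sub_distrib]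
    refine dvd_sub (h8'.trans (two_pow_dvd_sum_powerset_charSum A ε T)) ?_
    rw [← mul_sum]
    exact (h8'.trans (two_pow_dvd_sum_powerset_zt (cen A) T)).mul_left _
  have hres : ∀ J, w J % 8 = 0 ∨ w J % 8 = 4 := fun J => by have := h4 J; omega
  -- the sum of indicators is the number of `J` with `w J ≡ 4 (mod 8)`
  have hsum : (∑ J ∈ T.powerset, ind (decide (w J % 8 = 4))) =
      ((#(T.powerset.filter fun J => w J % 8 = 4) : ℕ) : ZMod 2) := by
    rw [← sum_boole]
    refine sum_congr rfl fun J _ => ?_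
    unfold ind
    by_cases h : w J % 8 = 4 <;> simp [h]
  have hmod : (∑ J ∈ T.powerset, w J) % 8 =
      (4 * ((#(T.powerset.filter fun J => w J % 8 = 4) : ℕ) : ℤ)) % 8 := by
    rw [sum_int_mod, ← sum_filter_add_sum_filter_not T.powerset (fun J => w J % 8 = 4)]
    have e1 : ∑ J ∈ T.powerset.filter (fun J => w J % 8 = 4), w J % 8 =
        4 * ((#(T.powerset.filter fun J => w J % 8 = 4) : ℕ) : ℤ) := by
      rw [sum_congr rfl fun J hJ => (mem_filter.mp hJ).2, sum_const, nsmul_eq_mul, mul_comm]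
    have e2 : ∑ J ∈ T.powerset.filter (fun J => ¬ w J % 8 = 4), w J % 8 = 0 :=
      sum_eq_zero fun J hJ => (hres J).resolve_right (mem_filter.mp hJ).2
    rw [e1, e2, add_zero]
  have heven : Even (#(T.powerset.filter fun J => w J % 8 = 4)) := by
    obtain ⟨c, hc⟩ := h8
    rw [hc] at hmod
    rw [Nat.even_iff]
    omega
  show (∑ J ∈ T.powerset, ind (decide (w J % 8 = 4))) = 0
  rw [hsum]
  exact (ZMod.natCast_eq_zero_iff_even).2 heven

/-- **Shape of the exceptional set.** For odd weights with odd total `S`: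
`χ_A(b) ≡ ±1 (mod 8)` iff `([g(b) odd] ↔ S ≡ ±3 (mod 8))` — the sign `(-1)^{b·c}` drops out because
`{±1}` is symmetric. [this work] -/
theorem exc_iff (hε : ∀ y, Odd (ε y)) (hS : Odd (∑ y ∈ A, ε y)) (b : Fin m → Bool) :
    ((∑ y ∈ A, ε y * zt b y) % 8 = 1 ∨ (∑ y ∈ A, ε y * zt b y) % 8 = 7) ↔
      (((∑ y ∈ A, ε y * zt b y - (∑ y ∈ A, ε y) * zt b (cen A)) % 8 = 4) ↔
        ((∑ y ∈ A, ε y) % 8 = 3 ∨ (∑ y ∈ A, ε y) % 8 = 5)) := by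
  obtain ⟨c, hc⟩ := charSum_sub_dvd_four A ε hε hS b
  have hS' := hS
  rw [Int.odd_iff] at hS'
  rcases zt_eq_one_or b (cen A) with hz | hz <;> rw [hz] at hc ⊢ <;> omega

/-- **The exceptional set is a word of `RM(2,m)`**: `b ↦ [χ_A(b) ≡ ±1 (mod 8)]` has degree `≤ 2`.
[this work] -/
theorem isDegLeFun_exc (hε : ∀ y, Odd (ε y)) (hS : Odd (∑ y ∈ A, ε y)) :
    IsDegLeFun 2 (fun b : Fin m → Bool =>
      decide ((∑ y ∈ A, ε y * zt b y) % 8 = 1 ∨ (∑ y ∈ A, ε y * zt b y) % 8 = 7)) := by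
  have hG : IsDegLeFun 2 (fun b : Fin m → Bool =>
      decide ((∑ y ∈ A, ε y * zt b y - (∑ y ∈ A, ε y) * zt b (cen A)) % 8 = 4)) :=
    isDegLeFun_of_anf_eq_zero fun T hT => anf_vanish hε hS T hT
  by_cases hτ : ((∑ y ∈ A, ε y) % 8 = 3 ∨ (∑ y ∈ A, ε y) % 8 = 5)
  · have e : (fun b : Fin m → Bool =>
        decide ((∑ y ∈ A, ε y * zt b y) % 8 = 1 ∨ (∑ y ∈ A, ε y * zt b y) % 8 = 7)) =
        fun b => decide ((∑ y ∈ A, ε y * zt b y - (∑ y ∈ A, ε y) * zt b (cen A)) % 8 = 4) := by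
      funext b
      exact decide_eq_decide.mpr ((exc_iff hε hS b).trans (iff_true_right hτ))
    rw [e]
    exact hG
  · have e : (fun b : Fin m → Bool =>
        decide ((∑ y ∈ A, ε y * zt b y) % 8 = 1 ∨ (∑ y ∈ A, ε y * zt b y) % 8 = 7)) =
        fun b => !decide ((∑ y ∈ A, ε y * zt b y - (∑ y ∈ A, ε y) * zt b (cen A)) % 8 = 4) := by
      funext b
      rw [← decide_not]
      exact decide_eq_decide.mpr ((exc_iff hε hS b).trans (iff_false_right hτ))
    rw [e]
    exact isDegLeFun_not hG

end SignedSet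

/-- **Exceptional sets are empty or large (`m = 9`).** For an odd signed set `A ⊆ 𝔽₂⁹`, the set of
`b` with `χ_A(b) ≡ ±1 (mod 8)` is empty or has at least `2⁹⁻² = 128` elements (minimum weight of
`RM(2,9)`). [this work] -/
theorem exc_card_ge {A : Finset (Fin 9 → Bool)} {ε : (Fin 9 → Bool) → ℤ} (hε : ∀ y, Odd (ε y))
    (hS : Odd (∑ y ∈ A, ε y))
    (hne : ∃ b : Fin 9 → Bool, (∑ y ∈ A, ε y * zt b y) % 8 = 1 ∨ (∑ y ∈ A, ε y * zt b y) % 8 = 7) :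
    128 ≤ #(univ.filter fun b : Fin 9 → Bool =>
      (∑ y ∈ A, ε y * zt b y) % 8 = 1 ∨ (∑ y ∈ A, ε y * zt b y) % 8 = 7) := by
  obtain ⟨b₀, hb₀⟩ := hne
  have h := bb_rmWeight_holds 9 2 _ (isDegLeFun_exc hε hS) ⟨b₀, decide_eq_true hb₀⟩
  have e : (univ.filter fun b : Fin 9 → Bool => decide ((∑ y ∈ A, ε y * zt b y) % 8 = 1 ∨
      (∑ y ∈ A, ε y * zt b y) % 8 = 7) = true) =
      univ.filter fun b : Fin 9 → Bool =>
        (∑ y ∈ A, ε y * zt b y) % 8 = 1 ∨ (∑ y ∈ A, ε y * zt b y) % 8 = 7 :=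
    filter_congr fun b _ => by rw [decide_eq_true_iff]
  rw [e] at h
  norm_num at h
  omega

end Summit.QuantumAdvantage.QuantumAdvantage.Theorems.NearExactIsExact.Negative.FibreResidueRM
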